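import Summits.SmoothPoincare4.SmoothPoincare4.Theses.SymplecticOrigami
import Summits.SmoothPoincare4.SmoothPoincare4.Theorems.SymplecticOrigamiNoGenusTwoDoorStubTaubesCanonicalCurve
import Summits.SmoothPoincare4.SmoothPoincare4.Theorems.SymplecticOrigamiNoGenusTwoDoorStubRankOneFlatComplement
import Summits.SmoothPoincare4.SmoothPoincare4.Theorems.SymplecticOrigamiNoGenusTwoDoorStubLiouvillePackaging
import Summits.SmoothPoincare4.SmoothPoincare4.Theorems.SymplecticOrigamiNoGenusTwoDoorStubClosingUp
import Literature.Geometry.Symplectic.ThomGysinComplementSurfaceFour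
import Literature.Geometry.Symplectic.SublevelPreconnectedOfRegular
import Literature.Geometry.Symplectic.CodimTwoComplementConnected

/-!
# `NoGenusTwoDoor` ⟺ the flat filling exclusion (line `canonical-cap-filling`, crux stmt-SmoothPoincare4-7842)

Route `SymplecticOrigami`, crux D = `NoGenusTwoDoor` (no closed connected symplectic 4-manifold
`(N, s)` has `(rank H₁, rank H₂) = (2, 1)` — a "door").  This file assembles the four landed stubs
of the line `canonical-cap-filling` (`Cruxes/NoGenusTwoDoor/Lines/canonical_cap_filling.lean`, lead
reshape r2) into the REDUCTION of the crux to its transfer target C⁺, the FLAT FILLING EXCLUSION: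

> there is no closed connected symplectic `(N, s)` containing a smoothly embedded `s`-symplectic
> genus-2 surface `B = b(S)` (`rank H₁(S) = 4`) with meridian injectivity (`H₁(N ∖ B) ↪ H₁(N)`,
> i.e. `B·B = +1`) whose open complement `U = N ∖ B` is exact (`s|_U = dθ`), flat (integral
> 2-cycles of `U` are torsion in `H₂(N)`) and Liouville-packaged (McLean: `N` minus a thin tube is a
> Liouville domain `(W, λ)` with `dλ = ι^* s`)

— uncapped: the genus-2 Boothby–Wang contact manifold `(Y_{2,−1}, ξ_BW)` has no exact filling with
vanishing rational intersection form.  Statements (all kernel-checked here, no `sorry`):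

* `noGenusTwoDoor_of_flatFillingExclusion` — C⁺ ⇒ D, modulo the two named published facts
  `Literature.Geometry.Symplectic.taubes_canonicalClass_symplecticCurve_four` (Taubes' SW ⇒ Gr for
  the canonical class at `b⁺ = 1`, chamber-free) and
  `Literature.Geometry.Symplectic.mclean_divisorComplement_convex_four` (McLean 2012, L.5.17: the
  exact complement of a symplectic divisor is finite-type convex); chain: door ⇒ Taubes genus-2 curve
  with meridian injectivity (`stub_taubesCanonicalCurve_of_taubes`, the Thom–Gysin input discharged)
  ⇒ exact + flat complement (`stub_rankOneFlatComplement`, unconditional) ⇒ Liouville packaging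
  (`stub_liouvillePackaging_of_mclean`, its connectedness and Milnor-retraction inputs discharged)
  ⇒ contradiction with C⁺.
* `flatFillingExclusion_of_noGenusTwoDoor` — D ⇒ C⁺, modulo the tree fact
  `Literature.Geometry.Symplectic.canonicalClass_sq_and_adjunction_of_symplectic_four`
  (`K² = 2χ + 3σ` and the adjunction equality): a flat meridian-injective genus-2 configuration
  closes up to a door (`stub_closingUp_of_canonicalClass`).
* `noGenusTwoDoor_iff_flatFillingExclusion` — the transfer is LOSSLESS: modulo the three facts,
  D ⟺ C⁺.

So the crux is reduced, with zero slack, to one statement about fillings of one Seifert contact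
3-manifold; the remaining content (the line's registered stub `stub_flatFillingExclusion`) is open
and recorded as such (Stipsicz 2002 Rem. 3.4; T.-J. Li 2015 §4.3.1; Kotschick 2006; Akhmedov–Zhang
2015 §2).  Sources: the line card `Lines/canonical-cap-filling.md`, the idea card
`Ideas/canonical-cap-filling.md`, Disproof.lean v4 of the crux (no stub kill), and the landed stub
files imported above.
-/

noncomputable section

-- the prescribed namespace `Summit.<P>.<Sub>.…` duplicates `SmoothPoincare4` (P = Sub)
set_option linter.dupNamespace false

open scoped Manifold ContDiff Topology ContinuousMap
open Set Function TopologicalSpace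
open Literature.Geometry.Kaehler (MForm IsSmoothForm IsClosedForm mextDeriv)
open Literature.AlgebraicTopology.SingularHomology
open Literature.Topology.FourManifolds (singularHomologyZ)
open Summit.SmoothPoincare4.SmoothPoincare4.Theses.SymplecticOrigami (NoGenusTwoDoor)

namespace Summit.SmoothPoincare4.SmoothPoincare4.Theorems.NoGenusTwoDoor.CanonicalCapFilling

/-- **C⁺ ⇒ D.** The flat filling exclusion implies `NoGenusTwoDoor`, modulo Taubes' canonical-class
curve theorem and McLean's convexity of divisor complements (named facts, taken as hypotheses):
a door carries Taubes' genus-2 curve with meridian injectivity (`stub_taubesCanonicalCurve_of_taubes`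
+ `thomGysin_complement_surface_four_holds`), at `b₂ = 1` its complement is exact and flat
(`stub_rankOneFlatComplement`), hence Liouville-packaged (`stub_liouvillePackaging_of_mclean` +
`isConnected_compl_range_of_isSmoothEmbedding_holds` +
`isPreconnected_sublevel_of_forall_mfderiv_ne_zero_holds`), which C⁺ forbids. [folklore] -/
theorem noGenusTwoDoor_of_flatFillingExclusion
    (hT : Literature.Geometry.Symplectic.taubes_canonicalClass_symplecticCurve_four)
    (hM : Literature.Geometry.Symplectic.mclean_divisorComplement_convex_four)
    (h4 : (∀ (N : Type) [TopologicalSpace N] [T2Space N] [SecondCountableTopology N] [CompactSpace N]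
        [ConnectedSpace N] [ChartedSpace (EuclideanSpace ℝ (Fin 4)) N] [IsManifold (𝓡 4) ∞ N]
        (s : MForm (𝓡 4) N ℝ 2)
        (S : Type) [TopologicalSpace S] [T2Space S] [CompactSpace S] [ConnectedSpace S]
        [ChartedSpace (EuclideanSpace ℝ (Fin 2)) S] [IsManifold (𝓡 2) ∞ S] (b : S → N) (U : Opens N),
        IsSmoothForm s → IsClosedForm s →
        (∀ x (v : TangentSpace (𝓡 4) x), v ≠ 0 → ∃ w, s x ![v, w] ≠ 0) →
        Module.finrank ℤ (singularHomologyZ S 1) = 4 →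
        Manifold.IsSmoothEmbedding (𝓡 2) (𝓡 4) ∞ b →
        (∀ y (v : TangentSpace (𝓡 2) y), v ≠ 0 → ∃ w : TangentSpace (𝓡 2) y,
          s (b y) ![mfderiv (𝓡 2) (𝓡 4) b y v, mfderiv (𝓡 2) (𝓡 4) b y w] ≠ 0) →
        (U : Set N) = (Set.range b)ᶜ →
        Function.Injective (singularHomology.map ℤ ℤ
          (⟨Subtype.val, continuous_subtype_val⟩ : C(↥(Set.range b)ᶜ, N)) 1) →
        (∃ θ : MForm (𝓡 4) U ℝ 1, IsSmoothForm θ ∧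
          mextDeriv θ = s.pullback (𝓡 4) (Subtype.val : U → N)) →
        (∀ x, IsOfFinAddOrder (singularHomology.map ℤ ℤ
          (⟨Subtype.val, continuous_subtype_val⟩ : C(↥(Set.range b)ᶜ, N)) 2 x)) →
        (∀ V : Set N, IsOpen V → Set.range b ⊆ V →
          ∃ (W : Type) (_ : TopologicalSpace W) (_ : T2Space W) (_ : SecondCountableTopology W)
            (_ : CompactSpace W) (_ : ConnectedSpace W) (_ : ChartedSpace (EuclideanHalfSpace 4) W)
            (_ : IsManifold (𝓡∂ 4) ∞ W) (lam : MForm (𝓡∂ 4) W ℝ 1) (ι : W → N),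
            Literature.Geometry.Symplectic.IsLiouvilleDomain W lam ∧
            ContMDiff (𝓡∂ 4) (𝓡 4) ∞ ι ∧ Function.Injective ι ∧
            (∀ x, Function.Injective (mfderiv (𝓡∂ 4) (𝓡 4) ι x)) ∧
            Set.range ι ⊆ (Set.range b)ᶜ ∧ Vᶜ ⊆ Set.range ι ∧
            mextDeriv lam = s.pullback (𝓡∂ 4) ι) →
        False)) :
    NoGenusTwoDoor := by
  intro N _ _ _ _ _ _ _ s hsm hcl hnd hdoor
  obtain ⟨hb1, hb2⟩ := hdoor
  obtain ⟨S, i₁, i₂, i₃, i₄, i₅, i₆, b, hS4, hemb, hsnd, hmer⟩ :=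
    stub_taubesCanonicalCurve_of_taubes hT
      Literature.Geometry.Symplectic.thomGysin_complement_surface_four_holds N s hsm hcl hnd hb1 hb2
  obtain ⟨hexact, hflat⟩ := stub_rankOneFlatComplement N s S b hsm hcl hnd hb2 hemb hsnd
  -- the open complement `N ∖ B` as an open submanifold
  let U : Opens N :=
    ⟨(Set.range b)ᶜ, (isCompact_range hemb.isEmbedding.continuous).isClosed.isOpen_compl⟩
  have hU : (U : Set N) = (Set.range b)ᶜ := rfl
  exact h4 N s S b U hsm hcl hnd hS4 hemb hsnd hU hmer (hexact _ hU) hflat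
    (stub_liouvillePackaging_of_mclean hM
      Literature.Geometry.Symplectic.isConnected_compl_range_of_isSmoothEmbedding_holds
      Literature.Geometry.Symplectic.isPreconnected_sublevel_of_forall_mfderiv_ne_zero_holds
      N s S b U hsm hcl hnd hemb hsnd hU (hexact _ hU))

/-- **D ⇒ C⁺.** `NoGenusTwoDoor` implies the flat filling exclusion, modulo the tree fact
`canonicalClass_sq_and_adjunction_of_symplectic_four` (`K² = 2χ + 3σ`, adjunction equality): a
flat, meridian-injective genus-2 symplectic configuration closes up to a door
(`stub_closingUp_of_canonicalClass`). [folklore] -/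
theorem flatFillingExclusion_of_noGenusTwoDoor
    (hA : Literature.Geometry.Symplectic.canonicalClass_sq_and_adjunction_of_symplectic_four)
    (hD : NoGenusTwoDoor) :
    (∀ (N : Type) [TopologicalSpace N] [T2Space N] [SecondCountableTopology N] [CompactSpace N]
        [ConnectedSpace N] [ChartedSpace (EuclideanSpace ℝ (Fin 4)) N] [IsManifold (𝓡 4) ∞ N]
        (s : MForm (𝓡 4) N ℝ 2)
        (S : Type) [TopologicalSpace S] [T2Space S] [CompactSpace S] [ConnectedSpace S]
        [ChartedSpace (EuclideanSpace ℝ (Fin 2)) S] [IsManifold (𝓡 2) ∞ S] (b : S → N) (U : Opens N),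
        IsSmoothForm s → IsClosedForm s →
        (∀ x (v : TangentSpace (𝓡 4) x), v ≠ 0 → ∃ w, s x ![v, w] ≠ 0) →
        Module.finrank ℤ (singularHomologyZ S 1) = 4 →
        Manifold.IsSmoothEmbedding (𝓡 2) (𝓡 4) ∞ b →
        (∀ y (v : TangentSpace (𝓡 2) y), v ≠ 0 → ∃ w : TangentSpace (𝓡 2) y,
          s (b y) ![mfderiv (𝓡 2) (𝓡 4) b y v, mfderiv (𝓡 2) (𝓡 4) b y w] ≠ 0) →
        (U : Set N) = (Set.range b)ᶜ →
        Function.Injective (singularHomology.map ℤ ℤ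
          (⟨Subtype.val, continuous_subtype_val⟩ : C(↥(Set.range b)ᶜ, N)) 1) →
        (∃ θ : MForm (𝓡 4) U ℝ 1, IsSmoothForm θ ∧
          mextDeriv θ = s.pullback (𝓡 4) (Subtype.val : U → N)) →
        (∀ x, IsOfFinAddOrder (singularHomology.map ℤ ℤ
          (⟨Subtype.val, continuous_subtype_val⟩ : C(↥(Set.range b)ᶜ, N)) 2 x)) →
        (∀ V : Set N, IsOpen V → Set.range b ⊆ V →
          ∃ (W : Type) (_ : TopologicalSpace W) (_ : T2Space W) (_ : SecondCountableTopology W)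
            (_ : CompactSpace W) (_ : ConnectedSpace W) (_ : ChartedSpace (EuclideanHalfSpace 4) W)
            (_ : IsManifold (𝓡∂ 4) ∞ W) (lam : MForm (𝓡∂ 4) W ℝ 1) (ι : W → N),
            Literature.Geometry.Symplectic.IsLiouvilleDomain W lam ∧
            ContMDiff (𝓡∂ 4) (𝓡 4) ∞ ι ∧ Function.Injective ι ∧
            (∀ x, Function.Injective (mfderiv (𝓡∂ 4) (𝓡 4) ι x)) ∧
            Set.range ι ⊆ (Set.range b)ᶜ ∧ Vᶜ ⊆ Set.range ι ∧
            mextDeriv lam = s.pullback (𝓡∂ 4) ι) →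
        False) := by
  intro N _ _ _ _ _ _ _ s S _ _ _ _ _ _ b U hsm hcl hnd hS4 hemb hsnd _hU hmer _hex hflat _hpack
  obtain ⟨hb1, hb2⟩ := stub_closingUp_of_canonicalClass hA N s S b hsm hcl hnd hS4 hemb hsnd hmer hflat
  exact hD N s hsm hcl hnd ⟨hb1, hb2⟩

/-- **The transfer is lossless** (registered sub-goal `stub_reduction_iff` of the crux item):
modulo the three named published facts (Taubes; McLean; `K² = 2χ + 3σ` + adjunction), the crux
`NoGenusTwoDoor` is EQUIVALENT to the flat filling exclusion C⁺ — the one statement left open by the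
line `canonical-cap-filling`. [folklore] -/
theorem stub_reduction_iff :
    Literature.Geometry.Symplectic.taubes_canonicalClass_symplecticCurve_four →
    Literature.Geometry.Symplectic.mclean_divisorComplement_convex_four →
    Literature.Geometry.Symplectic.canonicalClass_sq_and_adjunction_of_symplectic_four →
    (Summit.SmoothPoincare4.SmoothPoincare4.Theses.SymplecticOrigami.NoGenusTwoDoor ↔
    (∀ (N : Type) [TopologicalSpace N] [T2Space N] [SecondCountableTopology N] [CompactSpace N]
        [ConnectedSpace N] [ChartedSpace (EuclideanSpace ℝ (Fin 4)) N] [IsManifold (𝓡 4) ∞ N]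
        (s : MForm (𝓡 4) N ℝ 2)
        (S : Type) [TopologicalSpace S] [T2Space S] [CompactSpace S] [ConnectedSpace S]
        [ChartedSpace (EuclideanSpace ℝ (Fin 2)) S] [IsManifold (𝓡 2) ∞ S] (b : S → N) (U : Opens N),
        IsSmoothForm s → IsClosedForm s →
        (∀ x (v : TangentSpace (𝓡 4) x), v ≠ 0 → ∃ w, s x ![v, w] ≠ 0) →
        Module.finrank ℤ (singularHomologyZ S 1) = 4 →
        Manifold.IsSmoothEmbedding (𝓡 2) (𝓡 4) ∞ b →
        (∀ y (v : TangentSpace (𝓡 2) y), v ≠ 0 → ∃ w : TangentSpace (𝓡 2) y,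
          s (b y) ![mfderiv (𝓡 2) (𝓡 4) b y v, mfderiv (𝓡 2) (𝓡 4) b y w] ≠ 0) →
        (U : Set N) = (Set.range b)ᶜ →
        Function.Injective (singularHomology.map ℤ ℤ
          (⟨Subtype.val, continuous_subtype_val⟩ : C(↥(Set.range b)ᶜ, N)) 1) →
        (∃ θ : MForm (𝓡 4) U ℝ 1, IsSmoothForm θ ∧
          mextDeriv θ = s.pullback (𝓡 4) (Subtype.val : U → N)) →
        (∀ x, IsOfFinAddOrder (singularHomology.map ℤ ℤ
          (⟨Subtype.val, continuous_subtype_val⟩ : C(↥(Set.range b)ᶜ, N)) 2 x)) →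
        (∀ V : Set N, IsOpen V → Set.range b ⊆ V →
          ∃ (W : Type) (_ : TopologicalSpace W) (_ : T2Space W) (_ : SecondCountableTopology W)
            (_ : CompactSpace W) (_ : ConnectedSpace W) (_ : ChartedSpace (EuclideanHalfSpace 4) W)
            (_ : IsManifold (𝓡∂ 4) ∞ W) (lam : MForm (𝓡∂ 4) W ℝ 1) (ι : W → N),
            Literature.Geometry.Symplectic.IsLiouvilleDomain W lam ∧
            ContMDiff (𝓡∂ 4) (𝓡 4) ∞ ι ∧ Function.Injective ι ∧
            (∀ x, Function.Injective (mfderiv (𝓡∂ 4) (𝓡 4) ι x)) ∧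
            Set.range ι ⊆ (Set.range b)ᶜ ∧ Vᶜ ⊆ Set.range ι ∧
            mextDeriv lam = s.pullback (𝓡∂ 4) ι) →
        False)) :=
  fun hT hM hA => ⟨flatFillingExclusion_of_noGenusTwoDoor hA, noGenusTwoDoor_of_flatFillingExclusion hT hM⟩

end Summit.SmoothPoincare4.SmoothPoincare4.Theorems.NoGenusTwoDoor.CanonicalCapFilling

end
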